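import Literature.AnabelianGeometry.EtaleTheta.Discharge.Sec4NonVacuityCoveringThm44
import HarnessLib

/-!
# [EtTh] Thm 4.4 at the Kummer-tower toy for a NON-IDENTITY self-equivalence: twisting the constants
# (consistency witness — `Thm44Hyp` inhabited by `Ψ ≠ 𝟭`, all four Thm 4.4 closers fire)

S. Mochizuki, *The étale theta function and its Frobenioid-theoretic manifestations*, Publ. RIMS **45**
(2009) [MochizukiEtTh2009], §4, Thm 4.4 pp.93–95 (PDF): "`Ψ : C₁ ⥲ C₂` an equivalence of categories …".

CONSISTENCY WITNESS, TOY.  At `ToyCov.biKummerSetting` (p427822; `B = ℂˣ × (ℚ_{≥0})^gp`) every group automorphism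
`σ` of the constants `ℂˣ` induces a self-equivalence `Ψ_σ` of the Frobenioid (identity on objects, base, degrees
and divisors; `σ` on the constant part of the unit component `u_φ`) — e.g. `σ = (·)⁻¹` moves the unit "multiplication
by `2`" of `A_⊙`, so `Ψ_σ ≠ 𝟭`.  `Ψ_σ` (with `Ψ^bs = 𝟭`) inhabits abc-iut-L2-t3's `Thm44Hyp`, and the cell's Thm 4.4
closers FIRE for it with the birational transport `ψ_A := σ` on `O^×(A^birat)`: unlike the identity instance
(`ToyCov.thm44_id`, p428819), the inputs T44-L03 (Frobenius structure), T44-L10 (birational compatibility: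
restriction / fractions / `Aut`-action) and the reflected Frobenius-type clause are now exercised on a functor that
CHANGES morphisms.  Data (`def`s are toy objects: `unitTwist`, `unitTwistEquiv`, `twist`, `twistEquiv`,
`thm44HypTwist`, `ψTwist`); no `Prop` definition, no named fact, no instance.
* `ToyCov.twist_map_ne` — `Ψ_σ` is not the identity for `σ = (·)⁻¹`;
* `ToyCov.thm44_twist` — `Thm44_i ∧ Thm44_ii ∧ Thm44_iii ∧ Thm44_iv` for `h := thm44HypTwist σ`, `ψ := σ` on units.
HONEST LIMITS as for ToyCov (one base object, divisible exponents, trivial [FrdI] vocabularies, `Π^tp` trivial);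
consistency ≠ faithfulness; typed ≠ proved.  Nothing here bears on, or takes a side on, [IUTchIII] Cor. 3.12.
-/

noncomputable section

namespace Literature.AnabelianGeometry.EtaleTheta

open CategoryTheory Opposite Literature.AlgebraicGeometry.Frobenioids
open scoped NNRat

namespace ToyCov

section Twist

variable (σ : ℂˣ ≃* ℂˣ)

/-- Twisting the constant part of a rational function by `σ`: `(c, q, ξ) ↦ (σ c, q, ξ)` — a monoid endomorphism of
`B(A)` over the divisor map. [cite: MochizukiEtTh2009, Def 3.6 p.77] -/
def unitTwist (A : Baseᵒᵖ) : temperedFrobenioid.ratFnFunctor.obj A →* temperedFrobenioid.ratFnFunctor.obj A where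
  toFun x := ⟨((σ x.1.1.1, x.1.1.2), x.1.2), x.2⟩
  map_one' := Subtype.ext (Prod.ext (Prod.ext (map_one σ) rfl) rfl)
  map_mul' _ _ := Subtype.ext (Prod.ext (Prod.ext (map_mul σ _ _) rfl) rfl)

/-- `unitTwist σ` followed by `unitTwist σ⁻¹` is the identity. [cite: MochizukiEtTh2009, Def 3.6 p.77] -/
theorem unitTwist_symm_apply (A : Baseᵒᵖ) (x : temperedFrobenioid.ratFnFunctor.obj A) :
    unitTwist σ.symm A (unitTwist σ A x) = x :=
  Subtype.ext (Prod.ext (Prod.ext (σ.symm_apply_apply _) rfl) rfl)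

/-- The twist as a multiplicative equivalence of `B(A)`. [cite: MochizukiEtTh2009, Def 3.6 p.77] -/
def unitTwistEquiv (A : Baseᵒᵖ) : temperedFrobenioid.ratFnFunctor.obj A ≃* temperedFrobenioid.ratFnFunctor.obj A :=
  { unitTwist σ A with
    invFun := unitTwist σ.symm A
    left_inv := unitTwist_symm_apply σ A
    right_inv := fun x => by
      have h := unitTwist_symm_apply σ.symm A x
      rwa [MulEquiv.symm_symm] at h }

/-- The twist commutes with pull-back (which does not touch constants). [cite: MochizukiEtTh2009, Def 3.6 p.77] -/
theorem unitTwist_map {A A' : Baseᵒᵖ} (f : A ⟶ A') (x : temperedFrobenioid.ratFnFunctor.obj A) :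
    unitTwist σ A' ((temperedFrobenioid.ratFnFunctor.map f).hom x) =
      (temperedFrobenioid.ratFnFunctor.map f).hom (unitTwist σ A x) :=
  Subtype.ext rfl

/-- **The twisted self-functor `Ψ_σ`** of the Kummer-tower toy Frobenioid: identity on objects, base maps,
Frobenius degrees and divisors; `σ` on the constant part of `u_φ` (the relation of [FrdI] Thm 5.2 (i) only sees
`Div_B(u_φ)`, which `σ` preserves). [cite: MochizukiEtTh2009, Thm 4.4 p.93] -/
def twist : temperedFrobenioid.category ⥤ temperedFrobenioid.category where
  obj X := X
  map {X Y} φ := ModelFrobenioid.mkHom X Y (ModelFrobenioid.degFr φ) (ModelFrobenioid.baseMap φ)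
    (ModelFrobenioid.div φ) (unitTwist σ _ (ModelFrobenioid.unit φ)) φ.rel
  map_id X := ModelFrobenioid.hom_ext rfl rfl rfl (map_one (unitTwist σ _))
  map_comp φ ψ := ModelFrobenioid.hom_ext rfl rfl rfl (by
    change unitTwist σ _ ((temperedFrobenioid.ratFnFunctor.map (ModelFrobenioid.baseMap φ).op).hom
        (ModelFrobenioid.unit ψ) * ModelFrobenioid.unit φ ^ (ModelFrobenioid.degFr ψ : ℕ)) = _
    rw [map_mul, map_pow, unitTwist_map]
    rfl)

/-- `Ψ_{σ⁻¹} ∘ Ψ_σ = 𝟭` on morphisms. [cite: MochizukiEtTh2009, Thm 4.4 p.93] -/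
theorem twist_symm_map_twist_map {X Y : temperedFrobenioid.category} (φ : X ⟶ Y) :
    (twist σ.symm).map ((twist σ).map φ) = φ :=
  ModelFrobenioid.hom_ext rfl rfl rfl (unitTwist_symm_apply σ _ _)

/-- **`Ψ_σ` as a self-equivalence** (inverse `Ψ_{σ⁻¹}`, unit and counit identities).
[cite: MochizukiEtTh2009, Thm 4.4 p.93] -/
def twistEquiv : temperedFrobenioid.category ≌ temperedFrobenioid.category :=
  CategoryTheory.Equivalence.mk (twist σ) (twist σ.symm)
    (NatIso.ofComponents (fun X => Iso.refl X) (fun {X Y} φ => by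
      erw [Category.comp_id, Category.id_comp]
      exact (twist_symm_map_twist_map σ φ).symm))
    (NatIso.ofComponents (fun X => Iso.refl X) (fun {X Y} φ => by
      have h := twist_symm_map_twist_map σ.symm φ
      rw [MulEquiv.symm_symm] at h
      erw [Category.comp_id, Category.id_comp]
      exact h))

/-- **`Ψ_σ` inhabits `Thm44Hyp`** between the Kummer-tower toy setting and itself (`Ψ^bs = 𝟭`, `Base ∘ Ψ_σ = Base`).
[cite: MochizukiEtTh2009, Thm 4.4 p.93] -/
def thm44HypTwist : BiKummerSetting.Thm44Hyp biKummerSetting biKummerSetting where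
  isNonDilating₁ _ _ := trivial
  isNonDilating₂ _ _ := trivial
  baseShape₁ := ⟨(inferInstance : (𝟭 Base).Full), (inferInstance : (𝟭 Base).Faithful), pt,
    fun Y => ⟨fun _ => ⟨cover Y pt 1⟩, fun _ => ⟨Y, ⟨Iso.refl _⟩⟩⟩⟩
  baseShape₂ := ⟨(inferInstance : (𝟭 Base).Full), (inferInstance : (𝟭 Base).Faithful), pt,
    fun Y => ⟨fun _ => ⟨cover Y pt 1⟩, fun _ => ⟨Y, ⟨Iso.refl _⟩⟩⟩⟩
  isOpen_Hodot₁ := by rw [show biKummerSetting.Hodot = ⊤ from MonoidHom.ker_one, Subgroup.coe_top]; exact isOpen_univ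
  isOpen_Hodot₂ := by rw [show biKummerSetting.Hodot = ⊤ from MonoidHom.ker_one, Subgroup.coe_top]; exact isOpen_univ
  Ψ := twistEquiv σ
  Ψbs := CategoryTheory.Equivalence.refl
  comm := NatIso.ofComponents (fun _ => Iso.refl _) (fun _ => (Category.comp_id _).trans (Category.id_comp _).symm)
  mapsAodot := ⟨Iso.refl _⟩

/-- **`Ψ_σ` is NOT the identity** for `σ = (·)⁻¹`: it moves the unit "multiplication by `2`" of `A_⊙`.
[cite: MochizukiEtTh2009, Thm 4.4 p.93] -/
theorem twist_map_ne :
    (thm44HypTwist (MulEquiv.inv ℂˣ)).Ψ.functor.map (coefAut Aodot (Units.mk0 (2 : ℂ) two_ne_zero)).hom ≠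
      (coefAut Aodot (Units.mk0 (2 : ℂ) two_ne_zero)).hom := by
  intro h
  have h1 := congrArg (fun φ : Aodot ⟶ Aodot =>
    ((ModelFrobenioid.unit φ : temperedFrobenioid.ratFnFunctor.obj (op Aodot.base)).1.1.1 : ℂˣ)) h
  change ((Units.mk0 (2 : ℂ) two_ne_zero)⁻¹ : ℂˣ) = Units.mk0 (2 : ℂ) two_ne_zero at h1
  have h2 := congrArg (fun u : ℂˣ => (u : ℂ)) h1
  norm_num [Units.val_inv_eq_inv_val] at h2

/-- The birational transport `ψ_A := σ` on `O^×(A^birat) = B(A)^×` accompanying `Ψ_σ`.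
[cite: MochizukiEtTh2009, Thm 4.4 p.94] -/
def ψTwist (A : biKummerSetting.C) :
    biKummerSetting.biratUnits A ≃* biKummerSetting.biratUnits ((thm44HypTwist σ).Ψ.functor.obj A) :=
  Units.mapEquiv (unitTwistEquiv σ (op A.base))

/-- T44-L03 for `Ψ_σ`: degrees and divisors untouched; Frobenius type / pull-back morphisms re-certified by L1's
`isCoAngular` / `isPullbackMorphism_of`. [cite: MochizukiEtTh2009, Thm 4.4 p.95] -/
theorem thm44HypTwist_preservesFrobeniusStructure : (thm44HypTwist σ).PreservesFrobeniusStructure :=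
  ⟨fun _ _ _ => rfl, fun _ _ _ h => h,
    fun _ _ φ h => ⟨⟨ModelFrobenioid.isCoAngular ratFnFunctor_isGroupLike _, h.1.2⟩, h.2⟩,
    fun _ _ φ h => by
      obtain ⟨hn, hd⟩ := ModelFrobenioid.degFr_div_of_isPullbackMorphism divisorMonoid_isDivisorial h
      exact ModelFrobenioid.isPullbackMorphism_of divisorMonoid_isDivisorial ratFnFunctor_isGroupLike hn hd⟩

/-- T44-L10 for `Ψ_σ` and `ψ = σ`: `σ` commutes with restriction along pre-steps, with the fractions
`u_{s'} / u_{s''}` and with the `Aut`-action. [cite: MochizukiEtTh2009, Thm 4.4 p.95] -/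
theorem thm44HypTwist_biratCompatible : (thm44HypTwist σ).BiratCompatible (ψTwist σ) := by
  refine ⟨fun {A B} s hs ks f => Units.ext ?_, fun {A B} s' s'' _ _ _ _ _ _ => ?_, fun {A} τ f => Units.ext ?_⟩
  · exact unitTwist_map σ _ _
  · show ModelFrobenioid.unitU (temperedFrobenioid.isUnit_ratFnFunctor realified.isUnit_BΛ A) ((twist σ).map s') /
        ModelFrobenioid.unitU (temperedFrobenioid.isUnit_ratFnFunctor realified.isUnit_BΛ A) ((twist σ).map s'') =
      Units.map (unitTwist σ (op A.base))
        (ModelFrobenioid.unitU (temperedFrobenioid.isUnit_ratFnFunctor realified.isUnit_BΛ A) s' /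
          ModelFrobenioid.unitU (temperedFrobenioid.isUnit_ratFnFunctor realified.isUnit_BΛ A) s'')
    rw [map_div]
    exact congrArg₂ (· / ·) (Units.ext rfl) (Units.ext rfl)
  · exact unitTwist_map σ _ _

/-- **Thm 4.4 (i)–(iv) FIRE for the non-identity self-equivalence `Ψ_σ`** with `ψ_A := σ`: T44-L03, T44-L09/L09c
(trivial `Aut_D`), T44-L10, T44-L12, T44-L15b, the reflected Frobenius-type clause and "`C` is a Frobenioid"
(p428819) — then `thm44_i_of_inputs`, `thm44_ii_of_subnodes`, `thm44_iii_of_inputs`, `thm44_iv_of_prop43_ii`.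
[cite: MochizukiEtTh2009, Thm 4.4 p.94] -/
theorem thm44_twist :
    BiKummerSetting.Thm44_i (thm44HypTwist σ) ∧ BiKummerSetting.Thm44_ii (thm44HypTwist σ) (ψTwist σ) ∧
      BiKummerSetting.Thm44_iii (thm44HypTwist σ) (ψTwist σ) ∧
      BiKummerSetting.Thm44_iv (thm44HypTwist σ) (ψTwist σ)
        (fun {_ _} φ => temperedFrobenioid.pullFracModel φ) (fun {_ _} φ => temperedFrobenioid.pullFracModel φ) := by
  have hHodot : (thm44HypTwist σ).HodotCompatible := ⟨ContinuousMulEquiv.refl _, Subgroup.map_id _⟩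
  have hGal : (thm44HypTwist σ).GaloisCompatible := fun A _ =>
    ⟨trivial, Subgroup.ext fun τ => by
      rw [aut_eq_one _ τ]
      exact ⟨fun _ => one_mem _, fun _ => one_mem _⟩⟩
  have hPDS : (thm44HypTwist σ).PreservesDisjointSupports := fun _ _ _ _ h => h
  have hPNH : (thm44HypTwist σ).PreservesNHSaturatedBsFld := fun _ _ _ _ _ => Iff.rfl
  exact ⟨(thm44HypTwist σ).thm44_i_of_inputs temperedFrobenioid_isFrobenioid
      (thm44HypTwist_preservesFrobeniusStructure σ) hGal hHodot,
    (thm44HypTwist σ).thm44_ii_of_subnodes _ (thm44HypTwist_preservesFrobeniusStructure σ)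
      (thm44HypTwist_biratCompatible σ) hPDS,
    (thm44HypTwist σ).thm44_iii_of_inputs _ (thm44HypTwist_preservesFrobeniusStructure σ)
      (fun _ _ φ h => ⟨⟨ModelFrobenioid.isCoAngular ratFnFunctor_isGroupLike φ, h.1.2⟩, h.2⟩)
      temperedFrobenioid_isFrobenioid hPNH,
    BiKummerSetting.thm44_iv_of_prop43_ii (thm44HypTwist σ) _
      (fun {_ _} φ => temperedFrobenioid.pullFracModel φ) (fun {_ _} φ => temperedFrobenioid.pullFracModel φ)
      prop43_ii⟩

end Twist

end ToyCov

end Literature.AnabelianGeometry.EtaleTheta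

end
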